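import Summits.Ventures.CertifiedManyBodySolver.Observables.StiffnessThermalLeaf
import HarnessLib

/-!
# The thermal stiffness leaf AT ONE TEMPERATURE and the single-point Kosterlitz–Thouless closure

HONEST FRAMING: ladder R1–R4 with certified numbers; no claim on H/H₀. Cell `pub/hubbard-tc` (MO-S3 ORDER → T_c back-end),
seat `hubbard-tc-mod-2` (KT back-end), companion of `StiffnessThermalLeaf.lean` (hubbard-tc-p1): the interface a T > 0 certificate
family feeds (HOME/hubbard-tc-mod-2/KT-THERMAL-INTERFACE.md §1).

WHAT THIS IS NOT: not a T_c of any material; not a theorem that the Hubbard model has a Kosterlitz–Thouless transition. The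
dictionary fields of `ThermalKTDictionaryAt` (K2 stability, K1t identification) remain HYPOTHESES.

* §1 `ObsThermalStiffnessSeqCeilingAtBeta tp U n β c` — the leaf `ObsThermalStiffnessSeqCeilingAt` with the inverse temperature FIXED: at
  inverse temperature `β`, every thermal uniform flux-stiffness constant of the `(N_L, S^z = 0)` sectors along a sequence `L_j → ∞` is `≤ c`.
  This is the shape ONE certified thermal expectation value (e.g. a kinetic-energy ceiling of the sector Gibbs state at `β`) produces.
* §2 `ThermalKTDictionaryAt.le_inv_of_leafAtBeta` — **the single-temperature closure**: a leaf at `β` with `(π/4)·c < 1/β` forces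
  `Tc ≤ 1/β` for every profile obeying the monotonicity-free thermal KT dictionary. No monotonicity (K3), no temperature window, no
  interpolation: the Kosterlitz–Thouless STABILITY inequality at the one point `T = 1/β` is contradicted.

References: HazraVermaRanderia2019 eqs. (2)–(3) and p. 4 (the bound is evaluated AT `T_c`); NelsonKosterlitz1977; ScalapinoWhiteZhang1993 §II.
-/

noncomputable section

namespace Summit.Ventures.CertifiedManyBodySolver.Observables

open Filter Topology Set Real
open Literature.MathematicalPhysics.StatisticalMechanics
open Literature.MathematicalPhysics.StatisticalMechanics.KosterlitzThouless

/-! ## §1 The leaf at one inverse temperature -/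

/-- **Thermal stiffness leaf at ONE inverse temperature `β`** (any anchor `(U, n, t′)`): for every `ρ_s > 0` and scale `θ₀ > 0` and every
sequence of sides `L_j → ∞`, if `β ρ_s θ² ≤ log Z_{L_j}(0) − log Z_{L_j}(θ)` holds for `|θ| ≤ θ₀` at every side of the sequence (canonical
`(N_L, S^z = 0)` sector, `thermalFluxLogZ`), then `ρ_s ≤ c`. The `∀ β` conjunction of these is `ObsThermalStiffnessSeqCeilingAt`.
[cite: ScalapinoWhiteZhang1993, §II] -/
def ObsThermalStiffnessSeqCeilingAtBeta (tp U n β : ℝ) (c : ℚ) : Prop :=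
  ∀ (ρs θ₀ : ℝ), 0 < ρs → 0 < θ₀ → ∀ Ls : ℕ → ℕ, Tendsto Ls atTop atTop →
    (∀ (j : ℕ) [NeZero (Ls j)] (θ : ℝ), |θ| ≤ θ₀ →
      β * ρs * θ ^ 2 ≤ thermalFluxLogZ (Ls j) tp U (1 - n) β 0 - thermalFluxLogZ (Ls j) tp U (1 - n) β θ) →
    ρs ≤ ((c : ℚ) : ℝ)

/-- The uniform thermal leaf specialises to every single inverse temperature `β > 0`. [cite: ScalapinoWhiteZhang1993, §II] -/
theorem ObsThermalStiffnessSeqCeilingAt.atBeta {tp U n : ℝ} {c : ℚ} (h : ObsThermalStiffnessSeqCeilingAt tp U n c) {β : ℝ}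
    (hβ : 0 < β) : ObsThermalStiffnessSeqCeilingAtBeta tp U n β c :=
  fun ρs θ₀ hρs hθ₀ Ls hLs hst => h β ρs θ₀ hβ hρs hθ₀ Ls hLs hst

/-- Monotone transport of the single-temperature leaf in the constant. -/
theorem ObsThermalStiffnessSeqCeilingAtBeta.mono {tp U n β : ℝ} {c c' : ℚ} (h : ObsThermalStiffnessSeqCeilingAtBeta tp U n β c)
    (hcc : c ≤ c') : ObsThermalStiffnessSeqCeilingAtBeta tp U n β c' :=
  fun ρs θ₀ hρs hθ₀ Ls hLs hst => (h ρs θ₀ hρs hθ₀ Ls hLs hst).trans (by exact_mod_cast hcc)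

/-- **Single-temperature leaf + thermal identification at the same `β` ⇒ the identified level is below the ceiling.**
[cite: ScalapinoWhiteZhang1993, §II] -/
theorem IsThermalFluxStiffnessSeqAt.le_of_leafAtBeta {tp U n β ρ : ℝ} {c : ℚ} (h : IsThermalFluxStiffnessSeqAt tp U n β ρ)
    (hρ : 0 < ρ) (hleaf : ObsThermalStiffnessSeqCeilingAtBeta tp U n β c) : ρ ≤ ((c : ℚ) : ℝ) := by
  have hr : ∀ r : ℝ, 0 < r → r < ρ → r ≤ ((c : ℚ) : ℝ) := by
    intro r hr0 hrρ
    obtain ⟨θ₀, hθ₀, Ls, hLs, hst⟩ := h r hr0 hrρ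
    exact hleaf r θ₀ hr0 hθ₀ Ls hLs hst
  have hc : 0 < ((c : ℚ) : ℝ) := lt_of_lt_of_le (half_pos hρ) (hr _ (half_pos hρ) (half_lt_self hρ))
  refine le_of_forall_lt_imp_le_of_dense fun r hrρ => ?_
  rcases le_or_gt r 0 with hr0 | hr0
  · exact hr0.trans hc.le
  · exact hr r hr0 hrρ

/-! ## §2 The single-temperature Kosterlitz–Thouless closure -/

namespace ThermalKTDictionaryAt

variable {tp U n : ℝ} {ρe : ℝ → ℝ} {Tc : ℝ}

/-- **Single-temperature KT closure (no monotonicity, no window).** If the profile `ρₑ` with candidate `Tc` obeys the thermal KT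
dictionary at `(U, n, t′)`, and at ONE inverse temperature `β > 0` a leaf `ObsThermalStiffnessSeqCeilingAtBeta tp U n β c` holds with
`(π/4)·c < 1/β`, then `Tc ≤ 1/β`. Proof: were `1/β < Tc`, the stability field (K2) at `T = 1/β` would give `(2/π)·T ≤ ρₑ(T)/2` while the
identification (K1t) and the leaf give `ρₑ(T) ≤ c`, i.e. `T ≤ (π/4)·c` — contradiction. This is how ONE certified thermal kinetic (f-sum)
ceiling `κ` at `β` closes the row «`T_KT ≤ 1/β`» as soon as `(π/4)·(κ-leaf) < 1/β`. [cite: HazraVermaRanderia2019, eqs. (2)–(3)] -/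
theorem le_inv_of_leafAtBeta (h : ThermalKTDictionaryAt tp U n ρe Tc) {β : ℝ} (hβ : 0 < β) {c : ℚ}
    (hleaf : ObsThermalStiffnessSeqCeilingAtBeta tp U n β c) (hlt : π / 4 * ((c : ℚ) : ℝ) < 1 / β) : Tc ≤ 1 / β := by
  by_contra hnot
  push Not at hnot
  have hT : (0 : ℝ) < 1 / β := one_div_pos.2 hβ
  -- K2 at the single point `T = 1/β`
  have hstab : 2 / π * (1 / β) ≤ phaseStiffnessOfTwistCoeff 2 (ρe (1 / β)) := h.stable hT hnot
  rw [phaseStiffnessOfTwistCoeff_two] at hstab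
  -- K1t at `T = 1/β`, read at inverse temperature `1/(1/β) = β`
  have hid : IsThermalFluxStiffnessSeqAt tp U n β (ρe (1 / β)) := by
    have h1 := h.thermal hT hnot
    rwa [one_div_one_div] at h1
  have hpos : 0 < ρe (1 / β) := h.apply_pos hT hnot
  have hle : ρe (1 / β) ≤ ((c : ℚ) : ℝ) := hid.le_of_leafAtBeta hpos hleaf
  have hπ : 0 < π := Real.pi_pos
  -- `(2/π)(1/β) ≤ c/2` ⇒ `1/β ≤ (π/4) c`
  have h2 : 1 / β ≤ π / 4 * ((c : ℚ) : ℝ) := by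
    have h3 : 2 / π * (1 / β) ≤ ((c : ℚ) : ℝ) / 2 := hstab.trans (by linarith)
    have h4 : 2 / π * (1 / β) * π ≤ ((c : ℚ) : ℝ) / 2 * π := mul_le_mul_of_nonneg_right h3 hπ.le
    have h5 : 2 / π * (1 / β) * π = 2 * (1 / β) := by field_simp
    rw [h5] at h4
    linarith
  linarith

/-- **The same closure fed by the `∀β` leaf** (e.g. the kinematic or box leaves): `(π/4)·c < 1/β ⇒ Tc ≤ 1/β` — of course weaker than
`le_pi_div_four_mul` (`Tc ≤ (π/4)c`) but recorded as the shape a ROW «T_KT ≤ T₁» takes. [cite: HazraVermaRanderia2019, eqs. (2)–(3)] -/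
theorem le_inv_of_leaf_of_lt (h : ThermalKTDictionaryAt tp U n ρe Tc) {β : ℝ} (hβ : 0 < β) {c : ℚ}
    (hleaf : ObsThermalStiffnessSeqCeilingAt tp U n c) (hlt : π / 4 * ((c : ℚ) : ℝ) < 1 / β) : Tc ≤ 1 / β :=
  h.le_inv_of_leafAtBeta hβ (hleaf.atBeta hβ) hlt

/-- **Row form at the anchor `(8, ⅞, 0)`, `β = 4`**: a certified single-temperature leaf `ObsThermalStiffnessSeqCeilingAtBeta 0 8 (7/8) 4 c`
with `c < 0.3183098` (`< 1/π`, i.e. `(π/4)·c < 1/4`; e.g. `c = κ_x/2` from a certified thermal kinetic ceiling `⟨−k_x⟩_{β=4} ≤ κ_x < 0.6366196`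
of the sector Gibbs state) gives `Tc ≤ 1/4` for every profile obeying the thermal KT dictionary there — the row «T_KT ≤ t/4»,
monotonicity-free. [cite: HazraVermaRanderia2019, eqs. (2)–(3)] -/
theorem le_quarter_of_leafAtBeta_four {ρe : ℝ → ℝ} {Tc : ℝ} (h : ThermalKTDictionaryAt 0 8 (7 / 8) ρe Tc) {c : ℚ}
    (hleaf : ObsThermalStiffnessSeqCeilingAtBeta 0 8 (7 / 8) 4 c) (hc : ((c : ℚ) : ℝ) < 0.3183098) : Tc ≤ 1 / 4 := by
  refine h.le_inv_of_leafAtBeta (by norm_num) hleaf ?_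
  have h1 : π * ((c : ℚ) : ℝ) < π * 0.3183098 := mul_lt_mul_of_pos_left hc Real.pi_pos
  have h2 : π * (0.3183098 : ℝ) < 3.141593 * 0.3183098 := mul_lt_mul_of_pos_right Real.pi_lt_d6 (by norm_num)
  have h3 : (3.141593 : ℝ) * 0.3183098 < 1 := by norm_num
  linarith

end ThermalKTDictionaryAt

end Summit.Ventures.CertifiedManyBodySolver.Observables

end
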